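import Mathlib

/-!
# Route `IntegerScrew` — fast kernel arithmetic for manifest-certificate checks (1): offset fixed point over `ℕ`

Infrastructure for the kernel import of the SOS census brackets (`CensusBracketsRefPassed`,
`Theorems/ScrewManifestCertDefs.lean`) at `M = 48 … 112`, where the interval engine of
`Literature.Analysis.ValidatedNumerics` (≈ 0.7 ms per interval product in the kernel) is too slow by a factor
10–50 (measured by sos-eng-1 gen12).  The remedy is classical fixed-point arithmetic on NATURAL numbers with an
OFFSET: an integer `x`, `|x| < 2^200`, is stored as the natural `x + 2^200`; every operation is a handful of
GMP-backed `Nat` primitives with no sign case analysis, and each product is rounded once (floor).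

* `oval X = X − 2^200` (the integer stored), `SCL = 2^52` (values are `oval X / 2^52`);
* `oneg` (negation), `cmulRe/cmulIm` — the complex product `⌊(x₁y₁ − x₂y₂)/2^52⌋`, `⌊(x₁y₂ + x₂y₁)/2^52⌋`
  with exact semantics `oval_cmulRe/Im` under the size hypothesis `|x| ≤ 2^100`.
Pure arithmetic, RH-free and ζ-free; nothing here bears on the truth of RH.  Sequel:
`IntegerScrewCensusFastTrig` (exact Taylor `cos`/`sin`).
-/

set_option linter.dupNamespace false
set_option autoImplicit false

namespace Summit.RiemannHypothesis.RiemannHypothesis.Theorems.IntegerScrew.Manifest.Fast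

open Finset

/-! ### Constants and the offset encoding -/

/-- The fixed-point scale `2^52` (values are `x / 2^52`). -/
def SCL : ℕ := 2 ^ 52

/-- The offset `2^200`: the integer `x` is stored as the natural number `x + 2^200`. -/
def OFF : ℕ := 2 ^ 200

/-- The integer stored in an offset natural. -/
def oval (X : ℕ) : ℤ := (X : ℤ) - OFF

/-- `2^52 > 0` in `ℤ`. -/
theorem SCL_pos : (0 : ℤ) < SCL := by norm_num [SCL]

/-- `OFF = 2^200` in `ℤ`. -/
theorem OFF_val : (OFF : ℤ) = 2 ^ 200 := by norm_num [OFF]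

/-- `SCL = 2^52` in `ℤ`. -/
theorem SCL_val : (SCL : ℤ) = 2 ^ 52 := by norm_num [SCL]

/-- `oval (x + OFF) = x` for naturals. -/
theorem oval_add_OFF (x : ℕ) : oval (x + OFF) = x := by
  unfold oval; push_cast; ring

/-- Recover the natural from its value: `X = oval X + OFF`. -/
theorem cast_eq_oval (X : ℕ) : (X : ℤ) = oval X + OFF := by
  unfold oval; ring

/-- Negation: `2·OFF − X` stores `−x` (`X ≤ 2·OFF`). -/
def oneg (X : ℕ) : ℕ := 2 * OFF - X

/-- Semantics of `oneg`. -/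
theorem oval_oneg {X : ℕ} (h : |oval X| ≤ 2 ^ 199) : oval (oneg X) = -oval X := by
  unfold oneg
  have hX : X ≤ 2 * OFF := by
    have := (abs_le.1 h).2
    unfold oval at this
    zify
    rw [OFF_val] at this ⊢
    linarith
  unfold oval
  push_cast [Nat.cast_sub hX]
  ring

/-! ### The complex product with one rounding -/

/-- Real part of the fixed-point complex product, offset-encoded: `⌊(x₁y₁ − x₂y₂)/2^52⌋ + OFF`. -/
def cmulRe (X1 X2 Y1 Y2 : ℕ) : ℕ :=
  (X1 * Y1 + OFF * (X2 + Y2) + OFF * SCL - (X2 * Y2 + OFF * (X1 + Y1))) / SCL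

/-- Imaginary part of the fixed-point complex product, offset-encoded: `⌊(x₁y₂ + x₂y₁)/2^52⌋ + OFF`. -/
def cmulIm (X1 X2 Y1 Y2 : ℕ) : ℕ :=
  (X1 * Y2 + X2 * Y1 + (2 * OFF * OFF + OFF * SCL) - OFF * (X1 + X2 + Y1 + Y2)) / SCL

/-- **Semantics of `cmulRe`**: `⌊(x₁y₁ − x₂y₂)/2^52⌋`. -/
theorem oval_cmulRe {X1 X2 Y1 Y2 : ℕ} (h1 : |oval X1| ≤ 2 ^ 100) (h2 : |oval X2| ≤ 2 ^ 100)
    (h3 : |oval Y1| ≤ 2 ^ 100) (h4 : |oval Y2| ≤ 2 ^ 100) :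
    oval (cmulRe X1 X2 Y1 Y2) = (oval X1 * oval Y1 - oval X2 * oval Y2) / (SCL : ℤ) := by
  obtain ⟨a1, b1⟩ := abs_le.1 h1
  obtain ⟨a2, b2⟩ := abs_le.1 h2
  obtain ⟨a3, b3⟩ := abs_le.1 h3
  obtain ⟨a4, b4⟩ := abs_le.1 h4
  set x1 := oval X1
  set x2 := oval X2
  set y1 := oval Y1
  set y2 := oval Y2
  have e1 : (X1 : ℤ) = x1 + OFF := cast_eq_oval X1
  have e2 : (X2 : ℤ) = x2 + OFF := cast_eq_oval X2
  have e3 : (Y1 : ℤ) = y1 + OFF := cast_eq_oval Y1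
  have e4 : (Y2 : ℤ) = y2 + OFF := cast_eq_oval Y2
  have hp1 : |x1 * y1| ≤ 2 ^ 200 := by
    rw [abs_mul]; nlinarith [abs_nonneg x1, abs_nonneg y1, abs_le.2 ⟨a1, b1⟩, abs_le.2 ⟨a3, b3⟩]
  have hp2 : |x2 * y2| ≤ 2 ^ 200 := by
    rw [abs_mul]; nlinarith [abs_nonneg x2, abs_nonneg y2, abs_le.2 ⟨a2, b2⟩, abs_le.2 ⟨a4, b4⟩]
  have hkey : ((X1 * Y1 + OFF * (X2 + Y2) + OFF * SCL : ℕ) : ℤ) - ((X2 * Y2 + OFF * (X1 + Y1) : ℕ) : ℤ) =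
      x1 * y1 - x2 * y2 + OFF * SCL := by
    push_cast; rw [e1, e2, e3, e4]; ring
  have hle : X2 * Y2 + OFF * (X1 + Y1) ≤ X1 * Y1 + OFF * (X2 + Y2) + OFF * SCL := by
    have h0 : (0 : ℤ) ≤ x1 * y1 - x2 * y2 + OFF * SCL := by
      rw [OFF_val, SCL_val]
      nlinarith [(abs_le.1 hp1).1, (abs_le.1 hp2).2]
    have hk := hkey
    push_cast at hk
    zify
    linarith
  unfold cmulRe oval
  rw [Int.natCast_div, Nat.cast_sub hle, hkey, Int.add_mul_ediv_right _ _ SCL_pos.ne']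
  ring

/-- **Semantics of `cmulIm`**: `⌊(x₁y₂ + x₂y₁)/2^52⌋`. -/
theorem oval_cmulIm {X1 X2 Y1 Y2 : ℕ} (h1 : |oval X1| ≤ 2 ^ 100) (h2 : |oval X2| ≤ 2 ^ 100)
    (h3 : |oval Y1| ≤ 2 ^ 100) (h4 : |oval Y2| ≤ 2 ^ 100) :
    oval (cmulIm X1 X2 Y1 Y2) = (oval X1 * oval Y2 + oval X2 * oval Y1) / (SCL : ℤ) := by
  obtain ⟨a1, b1⟩ := abs_le.1 h1
  obtain ⟨a2, b2⟩ := abs_le.1 h2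
  obtain ⟨a3, b3⟩ := abs_le.1 h3
  obtain ⟨a4, b4⟩ := abs_le.1 h4
  set x1 := oval X1
  set x2 := oval X2
  set y1 := oval Y1
  set y2 := oval Y2
  have e1 : (X1 : ℤ) = x1 + OFF := cast_eq_oval X1
  have e2 : (X2 : ℤ) = x2 + OFF := cast_eq_oval X2
  have e3 : (Y1 : ℤ) = y1 + OFF := cast_eq_oval Y1
  have e4 : (Y2 : ℤ) = y2 + OFF := cast_eq_oval Y2
  have hp1 : |x1 * y2| ≤ 2 ^ 200 := by
    rw [abs_mul]; nlinarith [abs_nonneg x1, abs_nonneg y2, abs_le.2 ⟨a1, b1⟩, abs_le.2 ⟨a4, b4⟩]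
  have hp2 : |x2 * y1| ≤ 2 ^ 200 := by
    rw [abs_mul]; nlinarith [abs_nonneg x2, abs_nonneg y1, abs_le.2 ⟨a2, b2⟩, abs_le.2 ⟨a3, b3⟩]
  have hkey : ((X1 * Y2 + X2 * Y1 + (2 * OFF * OFF + OFF * SCL) : ℕ) : ℤ) -
      ((OFF * (X1 + X2 + Y1 + Y2) : ℕ) : ℤ) = x1 * y2 + x2 * y1 + OFF * SCL := by
    push_cast; rw [e1, e2, e3, e4]; ring
  have hle : OFF * (X1 + X2 + Y1 + Y2) ≤ X1 * Y2 + X2 * Y1 + (2 * OFF * OFF + OFF * SCL) := by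
    have h0 : (0 : ℤ) ≤ x1 * y2 + x2 * y1 + OFF * SCL := by
      rw [OFF_val, SCL_val]
      nlinarith [(abs_le.1 hp1).1, (abs_le.1 hp2).1]
    have hk := hkey
    push_cast at hk
    zify
    linarith
  unfold cmulIm oval
  rw [Int.natCast_div, Nat.cast_sub hle, hkey, Int.add_mul_ediv_right _ _ SCL_pos.ne']
  ring

end Summit.RiemannHypothesis.RiemannHypothesis.Theorems.IntegerScrew.Manifest.Fast
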